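import Summits.QuantumFields.YangMills.Theorems.UnitScaleTiltHalvingHSiteDatumOfSocketsTGamma
import Summits.QuantumFields.YangMills.Theorems.UnitScaleTiltHalvingHSiteTopRowsOfSocketsGamma
import Summits.QuantumFields.YangMills.Theorems.UnitScaleTiltHalvingP1FlatCoreSupplierInductionSU
import Literature.MathematicalPhysics.QuantumFieldTheory.Balaban1983to89.B8Thm4SupportLocalBdryG
import HarnessLib

/-!
# `hP1room` PROGRAMME — EDITION γ, v9 «hT4TLγ-REDUCE-γ» (LEAD-H ★w5-19200 g7 WORD 12 (2), px10 g3 LOCATE (L-B) 125947dd), FILE (2):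
# ★★ THE GUARDED THEOREM-4 SOCKET WITH SUPPORT CLAUSE `hT4Tγ` FROM THE THREE RAW γ-SOCKETS — ONE `exact` INTO lit's `G`-VALUED γ DRIVER

Route `UnitScaleTilt`, crux K1 child «MinimiserStabilityRegPr» (stmt-QuantumFields-19200), registered stub `stub_halvingStep` (`BirthV10`).  Cell `ym3-torus` (HUMAN RULING
D-0037: YM₃ on T³ is ladder rung R3 — NOT d = 4, NOT a mass gap, NOT the Clay problem), width seat `ym3-torus-px3` gen 4.  `--supports stmt-QuantumFields-19200 --as helper`;
THEOREMS ONLY (0 `def`, 0 `sorry`); count-neutral; nothing here claims `hT4TLγ`'s suppliers, `hSupUρ5`, the stub, the crux or the gap.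

WHY (px10 g3 LOCATE (L-B); LEAD-H WORD 12).  In edition γ the per-site composers consume the guarded Theorem-4 socket WITH SUPPORT CLAUSE `hT4Tγ`
(✓`HalvingHSiteDatumOfSocketsTGamma.siteDatum_of_T4Tγ`'s binder: ∀ `gJ` under J3's four guards, `∀ m ≤ K − n, ∃ u ∈ SU(2)` with `u = 1` off `□₀`, (1.29) at level `m`,
`W^u = U′`, Landau (1.38) for `1 ≤ m`, chart `A` self-adjoint of size `c⋆(Lʲη)⁻¹` on the touched sides), and the K-final displays it as the STEP socket `hT4TLγ`.  This file is
the γ twin of the T-edition reduce layer ✓`HalvingHSiteDatumOfSocketsT.hT4T_of_rawSockets` (✓p667955 §2): `hT4Tγ` ⟸ THREE raw sockets, each ∀ `gJ`-closed under J3's three guards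
((1.34)-𝔄 on `ℤᵈ`, axial for every family, tower row (d) `< s`) — Proposition 5's base ∕ step bodies IN `SU(2)`-FORM WITH SUPPORT (`hP5baseγ`, `hP5γ`; the τ-bodies lit
✓`B8SockHFPTraceFree.sockHFP₀_body_of_join_RD_traceFree` ∕ ✓`B8SockHFP59GammaTraceFree.sockHFP_body_of_join_59_γ_traceFree` serve them) and the ALL-LEVEL edition-γ (1.59)
socket `H59γ` (lit `H59Dβ` VERBATIM: class `cubeLamBP′ … (K−n) m` ∪ `CrossB □₀`, collar `Bbd`; px10 g3's ★`H59Dγ_allLevels_member5` driver-shape corollary is its supplier) —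
by ONE `exact` into lit ✓`B8Thm4SupportLocalBdryG.thm4_exists_all_levels_supp_landau138_γ_mem` (★w8-19936 g5, p678402) at `𝔸 := M₂(ℂ)`, `G := specialUnitaryUnits (Fin 2)`,
`U₀ := 1`, `U′ := pull (U^{gJ})♯ 0`, `Ω := cubeFam false L a M′ ρ′ (K−n)`, `Λs := cubeLamS …`, `Λb := cubeLamBP′ …` with PRINT's class laws lit ✓`cubeLamBP'_hbox_pred` ∕
✓`cubeLamBP'_hclass`, the boundary layer lit ✓`bdryLayer_cubeMember`, and Theorem 4's frame rows read off J3's guards: (1.33) lit ✓`one_inAk`, (1.34) ✓`h34_of_inAk_univ`,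
(Ax) ✓`hAx_of_inAx_one`, (1.35) under the γ box law ✓`HalvingHSiteTopRowsOfSocketsGamma.h135_cubeMember_γ`, (1.66)₀ from the fine row by lit ✓`collar_cube` + ✓`ends_of_sideTouches`.
The edition-γ (1.42) is INTERNAL to the driver (`H42_of_inAx_γ`) — no (1.42) socket.

WHAT IS PROVED (ns `…Theorems.HalvingHT4TGammaOfRawSocketsGamma`).
* ★★ `hT4Tγ_of_rawSocketsγ` — the driver's γ windows VERBATIM at `(d, L, α₀, a) := ((F.P K).d, (F.P K).L, ε₀, s)` (the packs supply them from `hw` by ✓`gammaWindows_of_hw`),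
  `s ≤ α₁`, `1 ≤ K − n`, the member's corner `a := Bᵏx₀ − t`, `ρ′ := ρ + M + L + S`; hypotheses `hP5baseγ hP5γ H59γ`; conclusion = `siteDatum_of_T4Tγ`'s `hT4Tγ` VERBATIM.
HONEST SCOPE.  Bookkeeping; nothing of Prop. 5, Theorem 4, (1.59) or [4] is proved here (sockets displayed ∕ supplied elsewhere: (1) px10, (3) w7 per WORD 12).

References: T. Bałaban, CMP **99** (1985) 75–102 [Balaban1985RegularSpaces] (Thm 4 p.88, Prop. 5 (1.106)–(1.109) p.94, (1.29) p.81, (1.31) p.82, (1.34)–(1.36) p.82, (1.42) p.83,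
(1.58)–(1.59) p.86, (1.66) p.87, p.98, p.76 («G = SU(N)»)); CMP **98** (1985) 17–51 [Balaban1985Averaging] ((42)–(43) pp.23–24).
-/


set_option autoImplicit false

noncomputable section

open scoped BigOperators Matrix.Norms.L2Operator
open NormedSpace
open Complex (I)

namespace Summit.QuantumFields.YangMills.Theorems.HalvingHT4TGammaOfRawSocketsGamma

open Literature.MathematicalPhysics.QuantumFieldTheory.Balaban1983to89
open Literature.MathematicalPhysics.QuantumFieldTheory.Balaban1983to89.T3ContinuumYM3Torus
open MatrixLog (mlog)
open B5Eq118OneStroke (iterBlockOf)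
open B7Prop1Explicit (e expUnit l1)
open B7Prop1Explicit renaming Site → LSite
open B7Prop2Explicit (unitaryUnits C0 c2' avgIter)
open B7Prop2SpecialUnitary (specialUnitaryUnits specialUnitaryUnits_le_unitaryUnits)
open B7Prop3Flat (c3)
open B7Prop1Local (InBox loK bondHiK)
open B7Eq92Concrete (mgauge)
open B8Ineq130 (tlo thi)
open B8Ineq132 (covDerivFwd InAk BondTouches)
open B8Eq119TwistedAxial (Restr129 InAx)
open B8Eq131Cubes (cube gs tLo tHi collar_cube)
open B8Eq131CubesAdmissible (cubeFam cubeFam_false_of_le)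
open B8CubeMemberZd (cubeLamS cubeLamB hΩ_cubeFam)
open B9SupplySockB9P3ZdGamma (cubeLamBP')
open B8CubeMemberLamBPrimeLaws (cubeLamBP'_hbox_pred cubeLamBP'_hclass)
open B8LeafKnitZd3CubBdryBeta (bdryLayer_cubeMember)
open B8Eq184Proof (gaugeExp cfgExp)
open B8Eq140Level (SideTouches)
open B8Eq146AExpansion (iEta)
open B8Eq138LandauZd (IsLandau138W)
open B7Prop4GeneralLevels (logCovIter linCovIter)
open B8Eq155JBound (Jcur wsup)
open B8ScaledSupNorm (bondNorm msup)
open B9SupplySockB9P3ZdBeta (CrossB)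
open B8Lemma1NonAbelian (mulCfg)
open B8Prop6OfThm4 (one_inAk)
open B8Thm4SupportLocalBdryG (thm4_exists_all_levels_supp_landau138_γ_mem)
open B10Eq27TorusAxialLog (transl rel pull pull_apply unitsField toUField suIncl gaugeActT unitsField_mem_unitaryUnits)
open HalvingP1FlatCoreSupplierInduction (h34_of_inAk_univ hAx_of_inAx_one ends_of_sideTouches)
open HalvingP1FlatCoreSupplierInductionSU (hu₁SU_of_mem)
open HalvingHSiteTopRowsOfSocketsGamma (h135_cubeMember_γ)

variable (F : T3Family) {n K : ℕ}

/-- ★★ **THE GUARDED THEOREM-4 SOCKET WITH SUPPORT CLAUSE FROM THE THREE RAW γ-SOCKETS** — `hT4Tγ` of ✓`HalvingHSiteDatumOfSocketsTGamma.siteDatum_of_T4Tγ` ⟸ the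
Proposition-5 base∕step bodies in `SU(2)`-form with support (`hP5baseγ`, `hP5γ`) and the all-level edition-γ (1.59) socket (`H59γ`, lit `H59Dβ`'s text at the member: class
`cubeLamBP′ … (K − n) m` ∪ `CrossB □₀`, collar `Bbd`), each ∀-closed over the member's `SU(2)` gauge UNDER J3's three guards; one `exact` into
lit ✓`B8Thm4SupportLocalBdryG.thm4_exists_all_levels_supp_landau138_γ_mem` at `G := specialUnitaryUnits (Fin 2)`, `U₀ := 1`, print's class laws and boundary layer by lit,
Theorem 4's frame read off the guards ((1.33)∕(1.34)∕(Ax)∕(1.35)γ∕(1.66)₀); the γ windows are the driver's VERBATIM at `(d, L, α₀, a) := ((F.P K).d, (F.P K).L, ε₀, s)`.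
[cite: Balaban1985RegularSpaces, Thm 4 p.88, Prop. 5 (1.106)-(1.109) p.94, (1.29) p.81, (1.31) p.82, (1.59) p.86, (1.66) p.87, p.98, p.76] -/
theorem hT4Tγ_of_rawSocketsγ (L : ℕ) (hF : F.L = L) (hk1 : 1 ≤ K - n) (ρ S M M' : ℕ) {ρ' : ℕ} (hρ'def : ρ' = ρ + M + L + S)
    {ε₀ : ℝ} (hε₀ : 0 < ε₀) {s : ℝ} (hs0 : 0 ≤ s) (U : GaugeField (F.P K) 0 (Matrix.specialUnitaryGroup (Fin 2) ℂ)) (x₀ : Site (F.P K) 0)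
    {t : ℤ} {a : LSite (F.P K).d} (hadef : a = fun μ => ((iterBlockOf (K - n) x₀ μ).val : ℤ) - t)
    -- Theorem 4's constants and the EDITION-γ windows (lit driver's binders VERBATIM at `d := (F.P K).d`, `L := (F.P K).L`, `α₀ := ε₀`, `a := s`)
    {α₁ α₄ B₀ cstar C₂ Bbd : ℝ} (hα₁ : 0 < α₁) (hα₄ : 0 ≤ α₄) (hB₀ : 0 ≤ B₀) (hsα₁ : s ≤ α₁) (hsmall₁ : ((F.P K).d : ℝ) * (F.P K).L * α₁ ≤ 1 / 8)
    (hc : cstar = 5 * (F.P K).d * (F.P K).L * B₀ * (ε₀ + α₁))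
    (hs₁ : α₄ ≤ 1 / 84) (hs₂ : (F.P K).L * cstar ≤ 1 / 12) (hsa4 : s ≤ 1 / 4) (hs2c : 2 * s ≤ cstar)
    (hα3 : C0 (F.P K).d * (((F.P K).L : ℝ) ^ 2 * ε₀) ≤ 1 / 3) (hα4 : 4 * (((F.P K).L : ℝ) ^ 2 * ε₀) ≤ c2' (F.P K).d (F.P K).L)
    (h16γ : 16 * (((F.P K).L : ℝ) * (2 * ((F.P K).L * cstar) + 8 * α₄)) ≤ 1)
    (h16 : 16 * (2 * ((F.P K).L * cstar) + 8 * α₄) ≤ 1) (hd5 : 5 * (2 * ((F.P K).L * cstar) + 8 * α₄) * (((F.P K).d : ℝ) - 1) ≤ 4)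
    (hsmall : Real.exp (4 * (800 * (((F.P K).d : ℝ) + 1) ^ 2 * (((F.P K).d : ℝ) + 4)) * (((F.P K).L : ℝ) ^ 2 * ε₀))
      * (1 + 8 * (131072 * (((F.P K).d : ℝ) + 1) ^ 2) * (((F.P K).L : ℝ) * (2 * ((F.P K).L * cstar) + 8 * α₄))) ≤ 2)
    (hc₃ : 2 * (((F.P K).L : ℝ) * (2 * ((F.P K).L * cstar) + 8 * α₄)) ≤ c3 (F.P K).d (F.P K).L)
    (hside : 36 * (F.P K).d * B₀ * (2 * ((F.P K).L * cstar) + 8 * α₄) ≤ 1 / 2)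
    (h50 : 50 * (F.P K).d * (2 * ((F.P K).L * cstar) + 8 * α₄) ≤ 1)
    (hBbd : 0 ≤ Bbd) (hbdry : 4 * Bbd * s ≤ (((F.P K).d : ℝ) * (F.P K).L - 1) * B₀ * (ε₀ + α₁))
    (hC₂ : 8 * (131072 * (((F.P K).d : ℝ) + 1) ^ 2) * Real.exp (4 * (800 * (((F.P K).d : ℝ) + 1) ^ 2 * (((F.P K).d : ℝ) + 4)) * (((F.P K).L : ℝ) ^ 2 * ε₀))
      * ((F.P K).L : ℝ) ^ 2 ≤ C₂)
    (h61 : 2 * (2 * ((F.P K).L * cstar) + 8 * α₄) ^ 2 + 20 * (F.P K).d * ε₀ * (2 * ((F.P K).L * cstar) + 8 * α₄)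
      + 2 * C₂ * (2 * ((F.P K).L * cstar) + 8 * α₄) ^ 2 ≤ ε₀ + α₁)
    -- THE THREE RAW γ-SOCKETS, ∀ `gJ`-closed UNDER J3's guards ((1.34)-𝔄 on `ℤᵈ` ∕ axial for every family ∕ tower row (d))
    (hP5baseγ : ∀ gJ : GaugeTransf (F.P K) 0 (Matrix.specialUnitaryGroup (Fin 2) ℂ),
      InAk (F.P K).L (K - n) (((F.L : ℝ)⁻¹) ^ (K - n)) ε₀ (fun _ => (Set.univ : Set (LSite (F.P K).d))) (pull (unitsField (toUField (GaugeField.gaugeAct gJ U))) 0) →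
      (∀ m', m' ≤ K - n → ∀ Λ : ℕ → Set (LSite (F.P K).d),
        InAx (F.P K).L m' Λ (1 : LSite (F.P K).d → Fin (F.P K).d → (Matrix (Fin 2) (Fin 2) ℂ)ˣ) (pull (unitsField (toUField (GaugeField.gaugeAct gJ U))) 0)) →
      (∀ m', m' ≤ K - n → ∀ (x : LSite (F.P K).d) (ν : Fin (F.P K).d), tlo (F.P K).L (tLo a ρ') m' ≤ x → x + e ν ≤ thi (F.P K).L (tHi a M' ρ') m' →
        ‖((avgIter (F.P K).L (pull (unitsField (toUField (GaugeField.gaugeAct gJ U))) 0) (K - n - m') x ν : (Matrix (Fin 2) (Fin 2) ℂ)ˣ) :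
            Matrix (Fin 2) (Fin 2) ℂ) - 1‖ < s) →
      ∃ (v : LSite (F.P K).d → (Matrix (Fin 2) (Fin 2) ℂ)ˣ) (lam : LSite (F.P K).d → (Matrix (Fin 2) (Fin 2) ℂ)),
        (∀ x, v x ∈ specialUnitaryUnits (Fin 2)) ∧ (∀ x, x ∉ cubeFam false (F.P K).L a M' ρ' (K - n) 0 → v x = 1) ∧
        (∀ j, j ≤ 1 → ∀ b ∈ {b : LSite (F.P K).d × Fin (F.P K).d | SideTouches (cubeFam false (F.P K).L a M' ρ' (K - n) j) b.1 b.2},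
          (v b.1 : Matrix (Fin 2) (Fin 2) ℂ) = ((gaugeExp lam b.1 : (Matrix (Fin 2) (Fin 2) ℂ)ˣ) : Matrix (Fin 2) (Fin 2) ℂ) ∧
          (v (b.1 + e b.2) : Matrix (Fin 2) (Fin 2) ℂ) = ((gaugeExp lam (b.1 + e b.2) : (Matrix (Fin 2) (Fin 2) ℂ)ˣ) : Matrix (Fin 2) (Fin 2) ℂ)) ∧
        (∀ j, j ≤ 1 → ∀ b ∈ {b : LSite (F.P K).d × Fin (F.P K).d | SideTouches (cubeFam false (F.P K).L a M' ρ' (K - n) j) b.1 b.2},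
          ‖lam b.1‖ ≤ α₄ ∧ (((F.P K).L : ℝ) ^ j * ((F.L : ℝ)⁻¹) ^ (K - n)) *
            ‖covDerivFwd (((F.L : ℝ)⁻¹) ^ (K - n)) (1 : LSite (F.P K).d → Fin (F.P K).d → (Matrix (Fin 2) (Fin 2) ℂ)ˣ) b.2 lam b.1‖ ≤ α₄) ∧
        IsLandau138W (F.P K).L 1 (((F.L : ℝ)⁻¹) ^ (K - n)) (cubeFam false (F.P K).L a M' ρ' (K - n) 0) (cubeLamS (F.P K).L a M' ρ' (K - n) 1)
          (1 : LSite (F.P K).d → Fin (F.P K).d → (Matrix (Fin 2) (Fin 2) ℂ)ˣ)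
          (mgauge (1 : LSite (F.P K).d → Fin (F.P K).d → (Matrix (Fin 2) (Fin 2) ℂ)ˣ) v⁻¹ (pull (unitsField (toUField (GaugeField.gaugeAct gJ U))) 0)) ∧
        Restr129 (F.P K).L 1 (cubeLamS (F.P K).L a M' ρ' (K - n) 1) (1 : LSite (F.P K).d → Fin (F.P K).d → (Matrix (Fin 2) (Fin 2) ℂ)ˣ)
          ((1 : LSite (F.P K).d → (Matrix (Fin 2) (Fin 2) ℂ)ˣ) * v))
    (hP5γ : ∀ gJ : GaugeTransf (F.P K) 0 (Matrix.specialUnitaryGroup (Fin 2) ℂ),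
      InAk (F.P K).L (K - n) (((F.L : ℝ)⁻¹) ^ (K - n)) ε₀ (fun _ => (Set.univ : Set (LSite (F.P K).d))) (pull (unitsField (toUField (GaugeField.gaugeAct gJ U))) 0) →
      (∀ m', m' ≤ K - n → ∀ Λ : ℕ → Set (LSite (F.P K).d),
        InAx (F.P K).L m' Λ (1 : LSite (F.P K).d → Fin (F.P K).d → (Matrix (Fin 2) (Fin 2) ℂ)ˣ) (pull (unitsField (toUField (GaugeField.gaugeAct gJ U))) 0)) →
      (∀ m', m' ≤ K - n → ∀ (x : LSite (F.P K).d) (ν : Fin (F.P K).d), tlo (F.P K).L (tLo a ρ') m' ≤ x → x + e ν ≤ thi (F.P K).L (tHi a M' ρ') m' →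
        ‖((avgIter (F.P K).L (pull (unitsField (toUField (GaugeField.gaugeAct gJ U))) 0) (K - n - m') x ν : (Matrix (Fin 2) (Fin 2) ℂ)ˣ) :
            Matrix (Fin 2) (Fin 2) ℂ) - 1‖ < s) →
      ∀ m, 1 ≤ m → m < K - n → ∀ (u₁ : LSite (F.P K).d → (Matrix (Fin 2) (Fin 2) ℂ)ˣ) (U₁ : LSite (F.P K).d → Fin (F.P K).d → (Matrix (Fin 2) (Fin 2) ℂ)ˣ)
        (A : LSite (F.P K).d → Fin (F.P K).d → Matrix (Fin 2) (Fin 2) ℂ),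
      (∀ x, u₁ x ∈ specialUnitaryUnits (Fin 2)) → (∀ x, x ∉ cubeFam false (F.P K).L a M' ρ' (K - n) 0 → u₁ x = 1) →
      mgauge (1 : LSite (F.P K).d → Fin (F.P K).d → (Matrix (Fin 2) (Fin 2) ℂ)ˣ) u₁ U₁ = pull (unitsField (toUField (GaugeField.gaugeAct gJ U))) 0 →
      Restr129 (F.P K).L m (cubeLamS (F.P K).L a M' ρ' (K - n) m) (1 : LSite (F.P K).d → Fin (F.P K).d → (Matrix (Fin 2) (Fin 2) ℂ)ˣ) u₁ →
      IsLandau138W (F.P K).L m (((F.L : ℝ)⁻¹) ^ (K - n)) (cubeFam false (F.P K).L a M' ρ' (K - n) 0) (cubeLamS (F.P K).L a M' ρ' (K - n) m)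
        (1 : LSite (F.P K).d → Fin (F.P K).d → (Matrix (Fin 2) (Fin 2) ℂ)ˣ) U₁ →
      (∀ j, j ≤ m → ∀ b ∈ {b : LSite (F.P K).d × Fin (F.P K).d | SideTouches (cubeFam false (F.P K).L a M' ρ' (K - n) j) b.1 b.2},
        U₁ b.1 b.2 = cfgExp (((F.L : ℝ)⁻¹) ^ (K - n)) A b.1 b.2 ∧ IsSelfAdjoint (A b.1 b.2) ∧
          ‖A b.1 b.2‖ ≤ cstar * (((F.P K).L : ℝ) ^ j * ((F.L : ℝ)⁻¹) ^ (K - n))⁻¹) →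
      ∃ (v : LSite (F.P K).d → (Matrix (Fin 2) (Fin 2) ℂ)ˣ) (lam : LSite (F.P K).d → (Matrix (Fin 2) (Fin 2) ℂ)),
        (∀ x, v x ∈ specialUnitaryUnits (Fin 2)) ∧ (∀ x, x ∉ cubeFam false (F.P K).L a M' ρ' (K - n) 0 → v x = 1) ∧
        (∀ j, j ≤ m + 1 → ∀ b ∈ {b : LSite (F.P K).d × Fin (F.P K).d | SideTouches (cubeFam false (F.P K).L a M' ρ' (K - n) j) b.1 b.2},
          (v b.1 : Matrix (Fin 2) (Fin 2) ℂ) = ((gaugeExp lam b.1 : (Matrix (Fin 2) (Fin 2) ℂ)ˣ) : Matrix (Fin 2) (Fin 2) ℂ) ∧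
          (v (b.1 + e b.2) : Matrix (Fin 2) (Fin 2) ℂ) = ((gaugeExp lam (b.1 + e b.2) : (Matrix (Fin 2) (Fin 2) ℂ)ˣ) : Matrix (Fin 2) (Fin 2) ℂ)) ∧
        (∀ j, j ≤ m + 1 → ∀ b ∈ {b : LSite (F.P K).d × Fin (F.P K).d | SideTouches (cubeFam false (F.P K).L a M' ρ' (K - n) j) b.1 b.2},
          ‖lam b.1‖ ≤ α₄ ∧ (((F.P K).L : ℝ) ^ j * ((F.L : ℝ)⁻¹) ^ (K - n)) *
            ‖covDerivFwd (((F.L : ℝ)⁻¹) ^ (K - n)) (1 : LSite (F.P K).d → Fin (F.P K).d → (Matrix (Fin 2) (Fin 2) ℂ)ˣ) b.2 lam b.1‖ ≤ α₄) ∧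
        IsLandau138W (F.P K).L (m + 1) (((F.L : ℝ)⁻¹) ^ (K - n)) (cubeFam false (F.P K).L a M' ρ' (K - n) 0) (cubeLamS (F.P K).L a M' ρ' (K - n) (m + 1))
          (1 : LSite (F.P K).d → Fin (F.P K).d → (Matrix (Fin 2) (Fin 2) ℂ)ˣ)
          (mgauge (1 : LSite (F.P K).d → Fin (F.P K).d → (Matrix (Fin 2) (Fin 2) ℂ)ˣ) v⁻¹ U₁) ∧
        Restr129 (F.P K).L (m + 1) (cubeLamS (F.P K).L a M' ρ' (K - n) (m + 1)) (1 : LSite (F.P K).d → Fin (F.P K).d → (Matrix (Fin 2) (Fin 2) ℂ)ˣ) (u₁ * v))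
    (H59γ : ∀ gJ : GaugeTransf (F.P K) 0 (Matrix.specialUnitaryGroup (Fin 2) ℂ),
      InAk (F.P K).L (K - n) (((F.L : ℝ)⁻¹) ^ (K - n)) ε₀ (fun _ => (Set.univ : Set (LSite (F.P K).d))) (pull (unitsField (toUField (GaugeField.gaugeAct gJ U))) 0) →
      (∀ m', m' ≤ K - n → ∀ Λ : ℕ → Set (LSite (F.P K).d),
        InAx (F.P K).L m' Λ (1 : LSite (F.P K).d → Fin (F.P K).d → (Matrix (Fin 2) (Fin 2) ℂ)ˣ) (pull (unitsField (toUField (GaugeField.gaugeAct gJ U))) 0)) →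
      (∀ m', m' ≤ K - n → ∀ (x : LSite (F.P K).d) (ν : Fin (F.P K).d), tlo (F.P K).L (tLo a ρ') m' ≤ x → x + e ν ≤ thi (F.P K).L (tHi a M' ρ') m' →
        ‖((avgIter (F.P K).L (pull (unitsField (toUField (GaugeField.gaugeAct gJ U))) 0) (K - n - m') x ν : (Matrix (Fin 2) (Fin 2) ℂ)ˣ) :
            Matrix (Fin 2) (Fin 2) ℂ) - 1‖ < s) →
      ∀ m, 1 ≤ m → m ≤ K - n → ∀ (u : LSite (F.P K).d → (Matrix (Fin 2) (Fin 2) ℂ)ˣ) (W : LSite (F.P K).d → Fin (F.P K).d → (Matrix (Fin 2) (Fin 2) ℂ)ˣ)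
        (A' : LSite (F.P K).d → Fin (F.P K).d → Matrix (Fin 2) (Fin 2) ℂ),
      (∀ x, u x ∈ unitaryUnits (Matrix (Fin 2) (Fin 2) ℂ)) → (∀ x, x ∉ cubeFam false (F.P K).L a M' ρ' (K - n) 0 → u x = 1) →
      mgauge (1 : LSite (F.P K).d → Fin (F.P K).d → (Matrix (Fin 2) (Fin 2) ℂ)ˣ) u W = pull (unitsField (toUField (GaugeField.gaugeAct gJ U))) 0 →
      Restr129 (F.P K).L m (cubeLamS (F.P K).L a M' ρ' (K - n) m) (1 : LSite (F.P K).d → Fin (F.P K).d → (Matrix (Fin 2) (Fin 2) ℂ)ˣ) u →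
      IsLandau138W (F.P K).L m (((F.L : ℝ)⁻¹) ^ (K - n)) (cubeFam false (F.P K).L a M' ρ' (K - n) 0) (cubeLamS (F.P K).L a M' ρ' (K - n) m)
        (1 : LSite (F.P K).d → Fin (F.P K).d → (Matrix (Fin 2) (Fin 2) ℂ)ˣ) W →
      (∀ y τ, IsSelfAdjoint (A' y τ)) →
      (∀ j, j ≤ m → ∀ y τ, SideTouches (cubeFam false (F.P K).L a M' ρ' (K - n) j) y τ →
        W y τ = cfgExp (((F.L : ℝ)⁻¹) ^ (K - n)) A' y τ ∧
          ‖A' y τ‖ ≤ (2 * ((F.P K).L * cstar) + 8 * α₄) * (((F.P K).L : ℝ) ^ j * ((F.L : ℝ)⁻¹) ^ (K - n))⁻¹) →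
      (∀ y τ, (∀ j, j ≤ m → ¬ SideTouches (cubeFam false (F.P K).L a M' ρ' (K - n) j) y τ) → A' y τ = 0) →
      msup (F.P K).L m (((F.L : ℝ)⁻¹) ^ (K - n)) (-(1 : ℝ)) (fun j (b : LSite (F.P K).d × Fin (F.P K).d) => SideTouches (cubeFam false (F.P K).L a M' ρ' (K - n) j) b.1 b.2)
          (fun b => A' b.1 b.2)
          ≤ B₀ * (bondNorm (F.P K).L m (((F.L : ℝ)⁻¹) ^ (K - n)) (-(3 : ℝ)) (cubeFam false (F.P K).L a M' ρ' (K - n))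
                (fun x μ => Jcur (((F.L : ℝ)⁻¹) ^ (K - n)) (1 : LSite (F.P K).d → Fin (F.P K).d → (Matrix (Fin 2) (Fin 2) ℂ)ˣ) A' μ x)
            + wsup 1 (fun p : {p : ℕ × (LSite (F.P K).d × Fin (F.P K).d) //
                p.1 ≤ m ∧ (p.2 ∈ cubeLamBP' (F.P K).L a M' ρ' (K - n) m p.1 ∨ (p.1 = 0 ∧ CrossB (cubeFam false (F.P K).L a M' ρ' (K - n) 0) p.2))} =>
                linCovIter (F.P K).L (1 : LSite (F.P K).d → Fin (F.P K).d → (Matrix (Fin 2) (Fin 2) ℂ)ˣ) (iEta (((F.L : ℝ)⁻¹) ^ (K - n)) A') p.1.1 p.1.2.1 p.1.2.2))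
            + Bbd * msup (F.P K).L m (((F.L : ℝ)⁻¹) ^ (K - n)) (-(1 : ℝ))
                (fun j (b : LSite (F.P K).d × Fin (F.P K).d) => j = 0 ∧ SideTouches (cubeFam false (F.P K).L a M' ρ' (K - n) 0) b.1 b.2 ∧
                  ¬ BondTouches (cubeFam false (F.P K).L a M' ρ' (K - n) 0) b.1 b.2) (fun b => A' b.1 b.2) ∧
        msup (F.P K).L m (((F.L : ℝ)⁻¹) ^ (K - n)) (-(2 : ℝ))
            (fun j (t : Fin (F.P K).d × Fin (F.P K).d × LSite (F.P K).d) => SideTouches (cubeFam false (F.P K).L a M' ρ' (K - n) j) t.2.2 t.2.1)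
            (fun t => covDerivFwd (((F.L : ℝ)⁻¹) ^ (K - n)) (1 : LSite (F.P K).d → Fin (F.P K).d → (Matrix (Fin 2) (Fin 2) ℂ)ˣ) t.1 (fun z => A' z t.2.1) t.2.2)
          ≤ B₀ * (bondNorm (F.P K).L m (((F.L : ℝ)⁻¹) ^ (K - n)) (-(3 : ℝ)) (cubeFam false (F.P K).L a M' ρ' (K - n))
                (fun x μ => Jcur (((F.L : ℝ)⁻¹) ^ (K - n)) (1 : LSite (F.P K).d → Fin (F.P K).d → (Matrix (Fin 2) (Fin 2) ℂ)ˣ) A' μ x)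
            + wsup 1 (fun p : {p : ℕ × (LSite (F.P K).d × Fin (F.P K).d) //
                p.1 ≤ m ∧ (p.2 ∈ cubeLamBP' (F.P K).L a M' ρ' (K - n) m p.1 ∨ (p.1 = 0 ∧ CrossB (cubeFam false (F.P K).L a M' ρ' (K - n) 0) p.2))} =>
                linCovIter (F.P K).L (1 : LSite (F.P K).d → Fin (F.P K).d → (Matrix (Fin 2) (Fin 2) ℂ)ˣ) (iEta (((F.L : ℝ)⁻¹) ^ (K - n)) A') p.1.1 p.1.2.1 p.1.2.2))
            + Bbd * msup (F.P K).L m (((F.L : ℝ)⁻¹) ^ (K - n)) (-(1 : ℝ))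
                (fun j (b : LSite (F.P K).d × Fin (F.P K).d) => j = 0 ∧ SideTouches (cubeFam false (F.P K).L a M' ρ' (K - n) 0) b.1 b.2 ∧
                  ¬ BondTouches (cubeFam false (F.P K).L a M' ρ' (K - n) 0) b.1 b.2) (fun b => A' b.1 b.2)) :
    -- CONCLUSION = `siteDatum_of_T4Tγ`'s socket `hT4Tγ` VERBATIM
    ∀ gJ : GaugeTransf (F.P K) 0 (Matrix.specialUnitaryGroup (Fin 2) ℂ),
      InAk (F.P K).L (K - n) (((F.L : ℝ)⁻¹) ^ (K - n)) ε₀ (fun _ => (Set.univ : Set (LSite (F.P K).d))) (pull (unitsField (toUField (GaugeField.gaugeAct gJ U))) 0) →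
      (∀ m', m' ≤ K - n → ∀ Λ : ℕ → Set (LSite (F.P K).d),
        InAx (F.P K).L m' Λ (1 : LSite (F.P K).d → Fin (F.P K).d → (Matrix (Fin 2) (Fin 2) ℂ)ˣ) (pull (unitsField (toUField (GaugeField.gaugeAct gJ U))) 0)) →
      (∀ m', m' ≤ K - n → ∀ (x : LSite (F.P K).d) (ν : Fin (F.P K).d), tlo (F.P K).L (tLo a ρ') m' ≤ x → x + e ν ≤ thi (F.P K).L (tHi a M' ρ') m' →
        ‖((avgIter (F.P K).L (pull (unitsField (toUField (GaugeField.gaugeAct gJ U))) 0) (K - n - m') x ν : (Matrix (Fin 2) (Fin 2) ℂ)ˣ) :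
            Matrix (Fin 2) (Fin 2) ℂ) - 1‖ < s) →
      (∀ (x : LSite (F.P K).d) (ν : Fin (F.P K).d), tlo (F.P K).L (tLo a ρ') (K - n) ≤ x → x + e ν ≤ thi (F.P K).L (tHi a M' ρ') (K - n) →
        ‖((pull (unitsField (toUField (GaugeField.gaugeAct gJ U))) 0 x ν : (Matrix (Fin 2) (Fin 2) ℂ)ˣ) : Matrix (Fin 2) (Fin 2) ℂ) - 1‖ < s) →
      ∀ m, m ≤ K - n → ∃ u : LSite (F.P K).d → (Matrix (Fin 2) (Fin 2) ℂ)ˣ,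
        (∀ x, ((u x : (Matrix (Fin 2) (Fin 2) ℂ)ˣ) : Matrix (Fin 2) (Fin 2) ℂ) ∈ Matrix.specialUnitaryGroup (Fin 2) ℂ) ∧
        (∀ x, x ∉ cubeFam false (F.P K).L a M' ρ' (K - n) 0 → u x = 1) ∧
        Restr129 (F.P K).L m (cubeLamS (F.P K).L a M' ρ' (K - n) m) (1 : LSite (F.P K).d → Fin (F.P K).d → (Matrix (Fin 2) (Fin 2) ℂ)ˣ) u ∧
        ∃ W : LSite (F.P K).d → Fin (F.P K).d → (Matrix (Fin 2) (Fin 2) ℂ)ˣ,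
          mgauge (1 : LSite (F.P K).d → Fin (F.P K).d → (Matrix (Fin 2) (Fin 2) ℂ)ˣ) u W = pull (unitsField (toUField (GaugeField.gaugeAct gJ U))) 0 ∧
          (1 ≤ m → IsLandau138W (F.P K).L m (((F.L : ℝ)⁻¹) ^ (K - n)) (cubeFam false (F.P K).L a M' ρ' (K - n) 0) (cubeLamS (F.P K).L a M' ρ' (K - n) m)
            (1 : LSite (F.P K).d → Fin (F.P K).d → (Matrix (Fin 2) (Fin 2) ℂ)ˣ) W) ∧
          ∃ A : LSite (F.P K).d → Fin (F.P K).d → Matrix (Fin 2) (Fin 2) ℂ, ∀ j, j ≤ m →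
            ∀ b ∈ {b : LSite (F.P K).d × Fin (F.P K).d | SideTouches (cubeFam false (F.P K).L a M' ρ' (K - n) j) b.1 b.2},
              W b.1 b.2 = cfgExp (((F.L : ℝ)⁻¹) ^ (K - n)) A b.1 b.2 ∧ IsSelfAdjoint (A b.1 b.2) ∧
                ‖A b.1 b.2‖ ≤ cstar * (((F.P K).L : ℝ) ^ j * ((F.L : ℝ)⁻¹) ^ (K - n))⁻¹ := by
  subst hadef hρ'def
  intro gJ hInAk hInAx htw hfine m hm
  letI : CStarAlgebra (Matrix (Fin 2) (Fin 2) ℂ) := B10Eq29TubeLine.cstarAlgebraMatrix 2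
  have hd2 : 2 ≤ (F.P K).d := by rw [T3Family.P_d F K]; norm_num
  have hL2 : 2 ≤ (F.P K).L := (F.P K).hL.2
  have hL1 : 1 ≤ (F.P K).L := (F.P K).L_pos
  have hη : 0 < ((F.L : ℝ)⁻¹) ^ (K - n) := by
    have hL0 : (0 : ℝ) < F.L := by exact_mod_cast (F.P K).L_pos
    positivity
  have hρL : (F.P K).L ≤ ρ + M + L + S := by
    have hLF : (F.P K).L = F.L := rfl
    rw [hLF, hF]; omega
  have hρ1 : 1 ≤ ρ + M + L + S := hL1.trans hρL
  -- the member's data: `U₀ := 1`, `U′ := pull (U^{gJ})♯ 0`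
  have hU' : ∀ (x : LSite (F.P K).d) (κ : Fin (F.P K).d),
      pull (unitsField (toUField (GaugeField.gaugeAct gJ U))) 0 x κ ∈ unitaryUnits (Matrix (Fin 2) (Fin 2) ℂ) :=
    fun x κ => by rw [pull_apply]; exact unitsField_mem_unitaryUnits _ _
  have hU₀ : ∀ (x : LSite (F.P K).d) (κ : Fin (F.P K).d),
      (1 : LSite (F.P K).d → Fin (F.P K).d → (Matrix (Fin 2) (Fin 2) ℂ)ˣ) x κ ∈ unitaryUnits (Matrix (Fin 2) (Fin 2) ℂ) :=
    fun _ _ => (unitaryUnits (Matrix (Fin 2) (Fin 2) ℂ)).one_mem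
  -- Theorem 4's frame read off J3's guards: (1.33), (1.34), (Ax), (1.35)γ, (1.66)₀
  have h33 := one_inAk (𝔸 := Matrix (Fin 2) (Fin 2) ℂ) hL1 (K - n) hη hε₀
    (cubeFam false (F.P K).L (fun μ => ((iterBlockOf (K - n) x₀ μ).val : ℤ) - t) M' (ρ + M + L + S) (K - n))
  have h34 := h34_of_inAk_univ hInAk (cubeFam false (F.P K).L (fun μ => ((iterBlockOf (K - n) x₀ μ).val : ℤ) - t) M' (ρ + M + L + S) (K - n))
  have hAx := hAx_of_inAx_one hInAx (cubeLamS (F.P K).L (fun μ => ((iterBlockOf (K - n) x₀ μ).val : ℤ) - t) M' (ρ + M + L + S) (K - n))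
  have h135 := h135_cubeMember_γ (P := F.P K) (𝔸 := Matrix (Fin 2) (Fin 2) ℂ) hL2
    (fun μ => ((iterBlockOf (K - n) x₀ μ).val : ℤ) - t) M' hρ1 (htw := fun m' hm' x ν h1 h2 => lt_of_lt_of_le (htw m' hm' x ν h1 h2) hsα₁)
  have h66 : ∀ b ∈ {b : LSite (F.P K).d × Fin (F.P K).d |
      SideTouches (cubeFam false (F.P K).L (fun μ => ((iterBlockOf (K - n) x₀ μ).val : ℤ) - t) M' (ρ + M + L + S) (K - n) 0) b.1 b.2},
      ‖((pull (unitsField (toUField (GaugeField.gaugeAct gJ U))) 0 b.1 b.2 : (Matrix (Fin 2) (Fin 2) ℂ)ˣ) : Matrix (Fin 2) (Fin 2) ℂ) - 1‖ ≤ s := by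
    rintro ⟨y, τ⟩ hyτ
    rw [Set.mem_setOf_eq, cubeFam_false_of_le (F.P K).L _ M' (ρ + M + L + S) (Nat.zero_le (K - n))] at hyτ
    obtain ⟨h1, h2⟩ := ends_of_sideTouches (collar_cube hL2 hρ1 (Nat.zero_le (K - n))) hyτ
    exact (hfine y τ h1 h2).le
  have haα : s ≤ ((F.P K).d : ℝ) * (F.P K).L * α₁ := by
    have hdL : (1 : ℝ) ≤ ((F.P K).d : ℝ) * (F.P K).L := by
      have h1 : (1 : ℝ) ≤ ((F.P K).d : ℝ) := by exact_mod_cast (le_trans (by norm_num) hd2)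
      have h2 : (1 : ℝ) ≤ ((F.P K).L : ℝ) := by exact_mod_cast hL1
      nlinarith
    have : α₁ ≤ ((F.P K).d : ℝ) * (F.P K).L * α₁ := le_mul_of_one_le_left hα₁.le hdL
    exact hsα₁.trans this
  -- THE CALL (lit's `G`-valued γ driver at `G := SU(2)`), then the `SU(2)` letter of the socket
  obtain ⟨u, hu, huS, h129, W, hW, hLan, A, hA⟩ :=
    thm4_exists_all_levels_supp_landau138_γ_mem hd2 hη hL2 (K - n) (specialUnitaryUnits (Fin 2)) specialUnitaryUnits_le_unitaryUnits hU₀ hU'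
      hε₀ hα₁ hα₄ hB₀ hc hs₁ hs₂ hsa4 hs2c hα3 hα4 h16γ h16 hd5 hsmall hc₃ hside h50 hsmall₁ hBbd hs0 hbdry hC₂ h61
      (cubeFam false (F.P K).L (fun μ => ((iterBlockOf (K - n) x₀ μ).val : ℤ) - t) M' (ρ + M + L + S) (K - n))
      (hΩ_cubeFam (d := (F.P K).d) hL1 _ M' hρL (K - n))
      (cubeLamS (F.P K).L (fun μ => ((iterBlockOf (K - n) x₀ μ).val : ℤ) - t) M' (ρ + M + L + S) (K - n))
      (cubeLamBP' (F.P K).L (fun μ => ((iterBlockOf (K - n) x₀ μ).val : ℤ) - t) M' (ρ + M + L + S) (K - n))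
      (cubeLamBP'_hbox_pred (d := (F.P K).d) hL1 _ M' hρL (K - n)) (cubeLamBP'_hclass (d := (F.P K).d) hL1 _ M' hρL (K - n))
      h33 h34 hAx h135 h66
      (bdryLayer_cubeMember (d := (F.P K).d) hL2 _ M' (ρ + M + L + S) (K - n) hρL hk1) haα
      (hP5baseγ gJ hInAk hInAx htw) (hP5γ gJ hInAk hInAx htw) (H59γ gJ hInAk hInAx htw) m hm
  exact ⟨u, hu₁SU_of_mem hu, huS, h129, W, hW, hLan, A, hA⟩

end Summit.QuantumFields.YangMills.Theorems.HalvingHT4TGammaOfRawSocketsGamma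

end
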